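import Mathlib.Analysis.SpecialFunctions.SmoothTransition
import Mathlib.Analysis.Calculus.Deriv.Inv
import Mathlib.Analysis.Calculus.Deriv.Mul
import Mathlib.Analysis.Calculus.Deriv.Comp
import Literature.Topology.FourManifolds.CollarShrink
import Literature.Topology.FourManifolds.OpenCollarExistence
import HarnessLib

/-!
# The one-variable profile gluing an adapted Morse function to a triad Morse function
# (Milnor 1965, Lemma 3.7, analytic part)

Topic `Literature/Topology/FourManifolds`; first of three files (`AttachDataMorseProfile`,
`AttachDataMorseCollars`, `AttachDataMorseGluing`) proving Milnor, *Lectures on the h-cobordism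
theorem* (1965), Lemma 3.7 / Cor. 3.8 in the tree's language: an adapted Morse function `f` on a
compact manifold with boundary `W` and a Morse function `g` of a cobordism `(X; M, N)` glue, across
the attachment `W ∪_ψ X` of `CobordismAttachmentProofs.lean` (`AttachData`), to an adapted Morse
function of `W ∪_ψ X` whose critical points are those of `f` and of `g`, with the same indices.

The attachment glues the open pieces `W - ∂W` and `X - M` along long open collars, a collar point
of height `h > 0` over `∂W` being identified with the collar point of height `c² / h` over `M`
(`c = CollarShrink.shrinkConst ∈ (0, 1/2]`).  With collars *adapted* to `f` and `g`
(`AttachDataMorseCollars.lean`: `1 - f = a_W h / (1 + h)` and `g = a_X s / (1 + s)` in the collar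
heights `h`, `s`), the glued function is, on the seam family `h ∈ (0, ∞)`, the **profile**

* `Ξ(h) = χ(h) · P(h) + (1 - χ(h)) · Q(h)`, `P h = -a_W h / (1 + h)` (`= f - 1` read in `h`),
  `Q h = a_X c² / (h + c²)` (`= g` read in `h = c² / s`), `χ = Real.smoothTransition (h - 1)`
  (`0` for `h ≤ 1`, `1` for `h ≥ 2`),

smooth on `(0, ∞)` with **negative derivative** (`χ' ≥ 0`, `P < 0 < Q`, `P' < 0`, `Q' < 0` — the
sign pattern of `WallHandlebodyBlend.lean`), `= Q` on `(0, 1]`, `= P` on `[2, ∞)`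
(`exists_hasDerivAt_profile_neg` and its neighbours, stated on the explicit formula); and off the
seam it is continued by the **profile pair** `(L, U)` of `MorseGlueProfile.exists_pair`:

* `L u` (`= Ξ (u / (a_W - u))` for `u < a_W`, `= -u` for `u ≥ 2 a_W / 3`): the glued function
  on `W - ∂W` is `L ∘ (1 - f)`;
* `U v` (`= Ξ (c² (a_X - v) / v)` for `v < a_X`, `= v` for `v ≥ a_X / 2`): the glued function on
  `X - M` is `U ∘ g`;

both smooth on `(0, ∞)` with nowhere vanishing derivative (`L' < 0`, `U' > 0`), so composing
creates no critical point, equal to `-u` resp. `v` away from the collars, so the Hessians at the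
critical points of `f`, `g` are untouched, and matching along the seam:
`L (a_W h / (1 + h)) = U (a_X s / (1 + s))` for `s = c² / h`.  Everything here is proved (one
real variable; theorems only).

## References

* J. Milnor, *Lectures on the h-cobordism theorem*, Princeton (1965), Lemma 3.7, Cor. 3.8 (PDF
  p. 15). [MilnorHCobordism1965]
-/

open scoped Topology ContDiff
open Set Function Filter

noncomputable section

namespace Literature.Topology.FourManifolds

namespace MorseGlueProfile

open CollarShrink

/-! ### The smooth step `χ(h) = smoothTransition (h - 1)` -/

/-- `χ` is smooth with a nonnegative derivative, `= 0` on `(-∞, 1]`, `= 1` on `[2, ∞)`, valued in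
`[0, 1]`. [folklore] -/
theorem glueStep_props :
    ContDiff ℝ ∞ (fun h : ℝ => Real.smoothTransition (h - 1)) ∧
    (∀ h : ℝ, HasDerivAt (fun h : ℝ => Real.smoothTransition (h - 1))
        (deriv (fun h : ℝ => Real.smoothTransition (h - 1)) h) h ∧
      0 ≤ deriv (fun h : ℝ => Real.smoothTransition (h - 1)) h) ∧
    (∀ h : ℝ, h ≤ 1 → Real.smoothTransition (h - 1) = 0) ∧
    (∀ h : ℝ, 2 ≤ h → Real.smoothTransition (h - 1) = 1) ∧
    (∀ h : ℝ, Real.smoothTransition (h - 1) ∈ Icc (0 : ℝ) 1) := by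
  have hs : ContDiff ℝ ∞ (fun h : ℝ => Real.smoothTransition (h - 1)) :=
    Real.smoothTransition.contDiff.comp (contDiff_id.sub contDiff_const)
  have hm : Monotone (fun h : ℝ => Real.smoothTransition (h - 1)) := fun _ _ hst =>
    Real.smoothTransition.monotone (by linarith)
  refine ⟨hs, fun h => ⟨((hs.differentiable (by simp)).differentiableAt).hasDerivAt, hm.deriv_nonneg⟩,
    fun h hh => Real.smoothTransition.zero_of_nonpos (by linarith),
    fun h hh => Real.smoothTransition.one_of_one_le (by linarith),
    fun h => ⟨Real.smoothTransition.nonneg _, Real.smoothTransition.le_one _⟩⟩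

/-! ### The two branches `P h = -a_W h / (1 + h)`, `Q h = a_X c² / (h + c²)` -/

/-- `-a_W < P < 0` on `(0, ∞)` (`a_W > 0`). [folklore] -/
theorem lower_mem_Ioo {aW h : ℝ} (haW : 0 < aW) (hh : 0 < h) : -(aW * h / (1 + h)) ∈ Ioo (-aW) 0 := by
  have h0 : 0 < aW * h / (1 + h) := div_pos (mul_pos haW hh) (by linarith)
  have h1 : aW * h / (1 + h) < aW := by
    rw [div_lt_iff₀ (by linarith)]; nlinarith
  constructor <;> linarith

/-- `0 < Q < a_X` on `(0, ∞)` (`a_X > 0`). [folklore] -/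
theorem upper_mem_Ioo {aX h : ℝ} (haX : 0 < aX) (hh : 0 < h) :
    aX * shrinkConst ^ 2 / (h + shrinkConst ^ 2) ∈ Ioo 0 aX := by
  refine ⟨div_pos (mul_pos haX (pow_pos shrinkConst_pos 2)) (by positivity), ?_⟩
  rw [div_lt_iff₀ (by positivity)]
  nlinarith [pow_pos shrinkConst_pos 2]

/-- `P' = -a_W / (1 + h)²` (`h > 0`). [folklore] -/
theorem hasDerivAt_lower (aW : ℝ) {h : ℝ} (hh : 0 < h) :
    HasDerivAt (fun h : ℝ => -(aW * h / (1 + h))) (-(aW / (1 + h) ^ 2)) h := by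
  have h1 : (1 + h) ≠ 0 := by linarith
  have hd : HasDerivAt (fun h : ℝ => -(aW * h / (1 + h))) (-((aW * 1 * (1 + h) - aW * h * 1) / (1 + h) ^ 2)) h :=
    (((hasDerivAt_id' h).const_mul aW).div ((hasDerivAt_id' h).const_add 1) h1).neg
  have he : -((aW * 1 * (1 + h) - aW * h * 1) / (1 + h) ^ 2) = -(aW / (1 + h) ^ 2) := by
    congr 1
    field_simp
    ring
  exact he ▸ hd

/-- `Q' = -a_X c² / (h + c²)²` (`h > 0`). [folklore] -/
theorem hasDerivAt_upper (aX : ℝ) {h : ℝ} (hh : 0 < h) :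
    HasDerivAt (fun h : ℝ => aX * shrinkConst ^ 2 / (h + shrinkConst ^ 2))
      (-(aX * shrinkConst ^ 2 / (h + shrinkConst ^ 2) ^ 2)) h := by
  have hc := pow_pos shrinkConst_pos 2
  have h1 : (h + shrinkConst ^ 2) ≠ 0 := by positivity
  have hd : HasDerivAt (fun h : ℝ => aX * shrinkConst ^ 2 / (h + shrinkConst ^ 2))
      ((0 * (h + shrinkConst ^ 2) - aX * shrinkConst ^ 2 * 1) / (h + shrinkConst ^ 2) ^ 2) h :=
    (hasDerivAt_const h (aX * shrinkConst ^ 2)).div ((hasDerivAt_id' h).add_const (shrinkConst ^ 2)) h1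
  have he : (0 * (h + shrinkConst ^ 2) - aX * shrinkConst ^ 2 * 1) / (h + shrinkConst ^ 2) ^ 2 =
      -(aX * shrinkConst ^ 2 / (h + shrinkConst ^ 2) ^ 2) := by ring
  exact he ▸ hd

/-! ### The profile `Ξ(h) = χ(h) P(h) + (1 - χ(h)) Q(h)` -/

/-- **The profile** (Milnor's pieced-together function on the seam family): smooth on `(0, ∞)`,
with NEGATIVE derivative (`Ξ' = χ' (P - Q) + χ P' + (1 - χ) Q'` with `χ' ≥ 0`, `P < Q`,
`P' < 0`, `Q' < 0`), `= Q` on `(0, 1]`, `= P` on `[2, ∞)`, valued in `(-a_W, a_X)`.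
[cite: MilnorHCobordism1965, Lemma 3.7] -/
theorem profile_props {aW aX : ℝ} (haW : 0 < aW) (haX : 0 < aX) :
    ContDiffOn ℝ ∞ (fun h : ℝ => Real.smoothTransition (h - 1) * -(aW * h / (1 + h)) +
        (1 - Real.smoothTransition (h - 1)) * (aX * shrinkConst ^ 2 / (h + shrinkConst ^ 2))) (Ioi 0) ∧
    (∀ h : ℝ, 0 < h → ∃ d < 0,
      HasDerivAt (fun h : ℝ => Real.smoothTransition (h - 1) * -(aW * h / (1 + h)) +
        (1 - Real.smoothTransition (h - 1)) * (aX * shrinkConst ^ 2 / (h + shrinkConst ^ 2))) d h) ∧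
    (∀ h : ℝ, h ≤ 1 → Real.smoothTransition (h - 1) * -(aW * h / (1 + h)) +
        (1 - Real.smoothTransition (h - 1)) * (aX * shrinkConst ^ 2 / (h + shrinkConst ^ 2)) =
        aX * shrinkConst ^ 2 / (h + shrinkConst ^ 2)) ∧
    (∀ h : ℝ, 2 ≤ h → Real.smoothTransition (h - 1) * -(aW * h / (1 + h)) +
        (1 - Real.smoothTransition (h - 1)) * (aX * shrinkConst ^ 2 / (h + shrinkConst ^ 2)) =
        -(aW * h / (1 + h))) ∧
    (∀ h : ℝ, 0 < h → Real.smoothTransition (h - 1) * -(aW * h / (1 + h)) +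
        (1 - Real.smoothTransition (h - 1)) * (aX * shrinkConst ^ 2 / (h + shrinkConst ^ 2)) ∈
        Ioo (-aW) aX) := by
  obtain ⟨hχs, hχd, hχ0, hχ1, hχI⟩ := glueStep_props
  refine ⟨?_, fun h hh => ?_, fun h hh => by simp [hχ0 h hh], fun h hh => by simp [hχ1 h hh],
    fun h hh => ?_⟩
  · -- smoothness
    have hP : ContDiffOn ℝ ∞ (fun h : ℝ => -(aW * h / (1 + h))) (Ioi 0) := by
      refine ((contDiffOn_const.mul contDiffOn_id).div (contDiffOn_const.add contDiffOn_id) ?_).neg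
      intro h hh; simp only [mem_Ioi] at hh; show (1 : ℝ) + h ≠ 0; linarith
    have hQ : ContDiffOn ℝ ∞ (fun h : ℝ => aX * shrinkConst ^ 2 / (h + shrinkConst ^ 2)) (Ioi 0) := by
      refine contDiffOn_const.div (contDiffOn_id.add contDiffOn_const) ?_
      intro h hh; simp only [mem_Ioi] at hh
      show h + shrinkConst ^ 2 ≠ 0
      have := pow_pos shrinkConst_pos 2; linarith
    exact (hχs.contDiffOn.mul hP).add ((contDiffOn_const.sub hχs.contDiffOn).mul hQ)
  · -- the derivative is negative
    obtain ⟨hχd', hχ0'⟩ := hχd h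
    have hP := hasDerivAt_lower aW hh
    have hQ := hasDerivAt_upper aX hh
    have hd : HasDerivAt (fun h : ℝ => Real.smoothTransition (h - 1) * -(aW * h / (1 + h)) +
        (1 - Real.smoothTransition (h - 1)) * (aX * shrinkConst ^ 2 / (h + shrinkConst ^ 2)))
        (deriv (fun h : ℝ => Real.smoothTransition (h - 1)) h * -(aW * h / (1 + h)) +
          Real.smoothTransition (h - 1) * -(aW / (1 + h) ^ 2) +
          ((0 - deriv (fun h : ℝ => Real.smoothTransition (h - 1)) h) *
              (aX * shrinkConst ^ 2 / (h + shrinkConst ^ 2)) +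
            (1 - Real.smoothTransition (h - 1)) * -(aX * shrinkConst ^ 2 / (h + shrinkConst ^ 2) ^ 2))) h :=
      (hχd'.mul hP).add (((hasDerivAt_const h (1 : ℝ)).sub hχd').mul hQ)
    refine ⟨_, ?_, hd⟩
    have hχ := hχI h
    have hPQ : -(aW * h / (1 + h)) - aX * shrinkConst ^ 2 / (h + shrinkConst ^ 2) < 0 := by
      linarith [(lower_mem_Ioo haW hh).2, (upper_mem_Ioo haX hh).1]
    have hP' : 0 < aW / (1 + h) ^ 2 := by positivity
    have hQ' : 0 < aX * shrinkConst ^ 2 / (h + shrinkConst ^ 2) ^ 2 := by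
      have := shrinkConst_pos; positivity
    have key : 0 < Real.smoothTransition (h - 1) * (aW / (1 + h) ^ 2) +
        (1 - Real.smoothTransition (h - 1)) * (aX * shrinkConst ^ 2 / (h + shrinkConst ^ 2) ^ 2) := by
      rcases eq_or_lt_of_le hχ.1 with h0 | h0
      · rw [← h0]; linarith
      · nlinarith [hχ.2]
    nlinarith [mul_nonneg hχ0' (le_of_lt (neg_pos.2 hPQ))]
  · -- values
    have hχ := hχI h
    have hP := lower_mem_Ioo haW hh
    have hQ := upper_mem_Ioo haX hh
    constructor <;> nlinarith [hχ.1, hχ.2, hP.1, hP.2, hQ.1, hQ.2]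

/-! ### The profile pair `(L, U)` -/

/-- The change of variable `v = a_X s / (1 + s) ↦ c² (a_X - v) / v = c² / s` (`s > 0`).
[folklore] -/
theorem sq_mul_sub_collarStretch_div {aX s : ℝ} (haX : 0 < aX) (hs : 0 < s) :
    shrinkConst ^ 2 * (aX - collarStretch aX s) / collarStretch aX s = shrinkConst ^ 2 / s := by
  have h1 : (1 + s) ≠ 0 := by linarith
  have h2 : aX - collarStretch aX s = aX / (1 + s) := by
    rw [collarStretch]; field_simp; ring
  rw [h2, collarStretch]
  field_simp

/-- **The profile pair.**  For collar heights `a_W > 0`, `0 < a_X ≤ 1` there are `L U : ℝ → ℝ`,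
smooth on `(0, ∞)`, with `L' < 0` and `U' > 0` there, `L u = -u` for `u ≥ 2 a_W / 3`, `U v = v`
for `v ≥ a_X / 2`, `L < a_X` on `(0, ∞)`, `U < 1` on `(0, 1)`, and matching along the seam of
the attachment: `L (a_W h / (1 + h)) = U (a_X s / (1 + s))` for `s = c² / h`, `h > 0` — namely
`L u = Ξ (u / (a_W - u))` (`u < a_W`), `U v = Ξ (c² (a_X - v) / v)` (`v < a_X`) for the profile
`Ξ` of `profile_props`. [cite: MilnorHCobordism1965, Lemma 3.7, Cor. 3.8] -/
theorem exists_pair {aW aX : ℝ} (haW : 0 < aW) (haX : 0 < aX) (haX1 : aX ≤ 1) :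
    ∃ L U : ℝ → ℝ,
      ContDiffOn ℝ ∞ L (Ioi 0) ∧ ContDiffOn ℝ ∞ U (Ioi 0) ∧
      (∀ u, 0 < u → ∃ d < 0, HasDerivAt L d u) ∧ (∀ v, 0 < v → ∃ d > 0, HasDerivAt U d v) ∧
      (∀ u, 2 * aW / 3 ≤ u → L u = -u) ∧ (∀ v, aX / 2 ≤ v → U v = v) ∧
      (∀ u, 0 < u → L u < aX) ∧ (∀ v, 0 < v → v < 1 → U v < 1) ∧
      (∀ h, 0 < h → L (collarStretch aW h) = U (collarStretch aX (shrinkConst ^ 2 / h))) := by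
  obtain ⟨hΞs, hΞd, hΞ0, hΞ1, hΞI⟩ := profile_props haW haX
  set Ξ : ℝ → ℝ := fun h : ℝ => Real.smoothTransition (h - 1) * -(aW * h / (1 + h)) +
    (1 - Real.smoothTransition (h - 1)) * (aX * shrinkConst ^ 2 / (h + shrinkConst ^ 2)) with hΞ
  set L : ℝ → ℝ := fun u => if u < aW then Ξ (u / (aW - u)) else -u with hL
  set U : ℝ → ℝ := fun v => if v < aX then Ξ (shrinkConst ^ 2 * (aX - v) / v) else v with hU
  have hc := pow_pos shrinkConst_pos 2
  have hc1 : shrinkConst ^ 2 ≤ 1 := by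
    have h1 := shrinkConst_le_half
    have h2 := shrinkConst_pos
    nlinarith
  -- `L = -u` beyond two thirds of the collar
  have hLfar : ∀ u, 2 * aW / 3 ≤ u → L u = -u := by
    intro u hu
    simp only [hL]
    split_ifs with h
    · have hau : 0 < aW - u := by linarith
      have h2 : 2 ≤ u / (aW - u) := by rw [le_div_iff₀ hau]; linarith
      have h0 : aW ≠ 0 := haW.ne'
      have h3 : 1 + u / (aW - u) = aW / (aW - u) := by field_simp; ring
      simp only [hΞ]
      rw [hΞ1 _ h2, h3]
      congr 1
      field_simp
    · rfl
  -- `U = v` beyond half of the collar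
  have hUfar : ∀ v, aX / 2 ≤ v → U v = v := by
    intro v hv
    simp only [hU]
    split_ifs with h
    · have hv0 : 0 < v := by linarith
      have h1 : shrinkConst ^ 2 * (aX - v) / v ≤ 1 := by
        rw [div_le_iff₀ hv0]
        have : aX - v ≤ v := by linarith
        nlinarith
      have h3 : shrinkConst ^ 2 * (aX - v) / v + shrinkConst ^ 2 = shrinkConst ^ 2 * aX / v := by
        field_simp; ring
      have hc0 : shrinkConst ≠ 0 := shrinkConst_pos.ne'
      simp only [hΞ]
      rw [hΞ0 _ h1, h3]
      field_simp
    · rfl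
  -- local forms
  have hLev : ∀ u, u < aW → L =ᶠ[𝓝 u] (Ξ ∘ fun u => u / (aW - u)) := fun u h => by
    filter_upwards [Iio_mem_nhds h] with v hv
    exact if_pos hv
  have hLev' : ∀ u, aW ≤ u → L =ᶠ[𝓝 u] fun u => -u := fun u h => by
    filter_upwards [Ioi_mem_nhds (show 2 * aW / 3 < u by linarith)] with v hv
    exact hLfar v hv.le
  have hUev : ∀ v, v < aX → U =ᶠ[𝓝 v] (Ξ ∘ fun v => shrinkConst ^ 2 * (aX - v) / v) := fun v h => by
    filter_upwards [Iio_mem_nhds h] with w hw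
    exact if_pos hw
  have hUev' : ∀ v, aX ≤ v → U =ᶠ[𝓝 v] fun v => v := fun v h => by
    filter_upwards [Ioi_mem_nhds (show aX / 2 < v by linarith)] with w hw
    exact hUfar w hw.le
  refine ⟨L, U, ?_, ?_, ?_, ?_, hLfar, hUfar, ?_, ?_, ?_⟩
  · -- `L` smooth
    intro u hu
    simp only [mem_Ioi] at hu
    by_cases h : u < aW
    · have hin : ContDiffAt ℝ ∞ (fun u : ℝ => u / (aW - u)) u :=
        contDiffAt_id.div (contDiffAt_const.sub contDiffAt_id) (sub_ne_zero_of_ne (ne_of_gt h))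
      have hout : ContDiffAt ℝ ∞ Ξ (u / (aW - u)) :=
        hΞs.contDiffAt (Ioi_mem_nhds (div_pos hu (by linarith)))
      exact ((hout.comp u hin).congr_of_eventuallyEq (hLev u h)).contDiffWithinAt
    · exact (contDiffAt_id.neg.congr_of_eventuallyEq (hLev' u (not_lt.1 h))).contDiffWithinAt
  · -- `U` smooth
    intro v hv
    simp only [mem_Ioi] at hv
    by_cases h : v < aX
    · have hin : ContDiffAt ℝ ∞ (fun v : ℝ => shrinkConst ^ 2 * (aX - v) / v) v :=
        (contDiffAt_const.mul (contDiffAt_const.sub contDiffAt_id)).div contDiffAt_id hv.ne'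
      have hout : ContDiffAt ℝ ∞ Ξ (shrinkConst ^ 2 * (aX - v) / v) :=
        hΞs.contDiffAt (Ioi_mem_nhds (div_pos (mul_pos hc (by linarith)) hv))
      exact ((hout.comp (f := fun w : ℝ => shrinkConst ^ 2 * (aX - w) / w) v hin).congr_of_eventuallyEq
        (hUev v h)).contDiffWithinAt
    · exact (contDiffAt_id.congr_of_eventuallyEq (hUev' v (not_lt.1 h))).contDiffWithinAt
  · -- `L' < 0`
    intro u hu
    by_cases h : u < aW
    · have hau : 0 < aW - u := by linarith
      obtain ⟨d, hd, hD⟩ := hΞd (u / (aW - u)) (div_pos hu hau)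
      have hin : HasDerivAt (fun u : ℝ => u / (aW - u)) ((1 * (aW - u) - u * (0 - 1)) / (aW - u) ^ 2) u :=
        (hasDerivAt_id' u).div ((hasDerivAt_const u aW).sub (hasDerivAt_id' u)) hau.ne'
      have hin' : 0 < (1 * (aW - u) - u * (0 - 1)) / (aW - u) ^ 2 := by
        have : (1 * (aW - u) - u * (0 - 1)) = aW := by ring
        rw [this]; positivity
      exact ⟨_, mul_neg_of_neg_of_pos hd hin',
        (hD.comp u (h := fun u : ℝ => u / (aW - u)) hin).congr_of_eventuallyEq (hLev u h)⟩
    · exact ⟨-1, by norm_num, (hasDerivAt_neg u).congr_of_eventuallyEq (hLev' u (not_lt.1 h))⟩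
  · -- `U' > 0`
    intro v hv
    by_cases h : v < aX
    · obtain ⟨d, hd, hD⟩ := hΞd (shrinkConst ^ 2 * (aX - v) / v) (div_pos (mul_pos hc (by linarith)) hv)
      have hin : HasDerivAt (fun v : ℝ => shrinkConst ^ 2 * (aX - v) / v)
          ((shrinkConst ^ 2 * (0 - 1) * v - shrinkConst ^ 2 * (aX - v) * 1) / v ^ 2) v :=
        (((hasDerivAt_const v aX).sub (hasDerivAt_id' v)).const_mul (shrinkConst ^ 2)).div
          (hasDerivAt_id' v) hv.ne'
      have hin' : (shrinkConst ^ 2 * (0 - 1) * v - shrinkConst ^ 2 * (aX - v) * 1) / v ^ 2 < 0 := by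
        have : shrinkConst ^ 2 * (0 - 1) * v - shrinkConst ^ 2 * (aX - v) * 1 = -(shrinkConst ^ 2 * aX) := by
          ring
        rw [this]
        exact div_neg_of_neg_of_pos (by nlinarith) (by positivity)
      exact ⟨_, mul_pos_of_neg_of_neg hd hin',
        (hD.comp v (h := fun w : ℝ => shrinkConst ^ 2 * (aX - w) / w) hin).congr_of_eventuallyEq (hUev v h)⟩
    · exact ⟨1, one_pos, (hasDerivAt_id' v).congr_of_eventuallyEq (hUev' v (not_lt.1 h))⟩
  · -- `L < a_X`
    intro u hu
    simp only [hL]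
    split_ifs with h
    · exact (hΞI _ (div_pos hu (by linarith))).2
    · linarith
  · -- `U < 1` on `(0, 1)`
    intro v hv hv1
    simp only [hU]
    split_ifs with h
    · exact (hΞI _ (div_pos (mul_pos hc (by linarith)) hv)).2.trans_le haX1
    · exact hv1
  · -- matching along the seam
    intro h hh
    have hs : 0 < shrinkConst ^ 2 / h := div_pos hc hh
    simp only [hL, hU]
    rw [if_pos (collarStretch_lt haW hh.le), collarStretch_div_sub haW hh.le,
      if_pos (collarStretch_lt haX hs.le), sq_mul_sub_collarStretch_div haX hs,
      div_div_cancel₀ hc.ne']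

end MorseGlueProfile

end Literature.Topology.FourManifolds
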